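import Literature.NumberTheory.LFunctions.KMVHighDerivativeNonvanishing
import Mathlib.NumberTheory.LSeries.DirichletContinuation
import HarnessLib

/-!
# Bui–Pratt–Zaharescu 2024, §2: the mollified first and second harmonic moments of
`Λ'_{f,ψ}(½)` and `Λ''_{f,ψ}(½)` at prime level in the presence of an exceptional character
(Propositions 2.1–2.3, AS PRINTED; the calibration targets of the cell's D-fam-2)

Source: H. M. Bui, K. Pratt, A. Zaharescu, *Analytic ranks of automorphic L-functions and
Landau–Siegel zeros*, J. London Math. Soc. 109 (2024) e12834 = arXiv:2102.03087 [held: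
paper:arxiv-2102.03087], §2 pp. 3–6: (2.1)–(2.7), Propositions 2.1, 2.2, 2.3. Companion of
`AnalyticRanksLandauSiegel` (Theorems 1.1/1.2, same namespace `BPZ2024`, same conventions).

SETTING (§2, p. 3): `q` prime, `S₂*(q)` (`newforms0 q 2`), harmonic weights `ω_f = 1/4π⟨f,f⟩`
(`GL2Family.harmonicSum q 2`); "Throughout we let `D` be large and let `ψ` be a real, odd, primitive
Dirichlet character modulo `D` … We assume throughout that `L(1,ψ)(log D) = o(1)`"; `(D, q) = 1`
(automatic for prime `q > D`). Completed `L`-functions (2.1): `Λ(f, ½+s) := (√q/2π)^s Γ(1+s) L(f, ½+s)`,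
`Λ(f⊗ψ, ½+s) := (√q D/2π)^s Γ(1+s) L(f⊗ψ, ½+s)`, product `Λ_{f,ψ}(½+s) := Λ(f,½+s)Λ(f⊗ψ,½+s)
= −ψ(q) Λ_{f,ψ}(½−s)` (2.2); mollifier (2.3) `M_{f,ψ} = ∑_{a ≤ X} ρ₁(a)λ_f(a)a^{−1/2}`,
`ρ₁ = ((αμ) ⋆ (αμψ)) · h`, `α(n) = ∏_{p∣n}(1+1/p)^{−1}`, `h(n) = ∏_{p∣n}(1 + α(p)²ψ(p)/p)^{−1}`;
singular series `S₁` (2.6), `S₂ = S₁²` (2.7); `Q = qD/4π²`; `γ` = Euler's constant.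

## What is typed

Definitions `BPZ2024.{alpha, hfun, rho1, mollifier, Lambda, LambdaTw, LambdaProd, LambdaProdDeriv,
S1, S2, Qbpz}` with bodies (central values through the continuation of record
`IwaniecSarnak.entireLSeries`, weight `2`, `L(f, ½+u) = E(1+u)`), and the named facts
`buiPrattZaharescu2024_eq22` (the functional equation (2.2)), `buiPrattZaharescu2024_proposition21_first`,
`buiPrattZaharescu2024_proposition21_second`, `buiPrattZaharescu2024_proposition22`,
`buiPrattZaharescu2024_proposition23`.

## Faithfulness notes

* Quantifier rendering as in `AnalyticRanksLandauSiegel`: `ψ` primitive ∧ quadratic ∧ odd; "`D`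
  large" = `∃ D₀`; the standing "`L(1,ψ) log D = o(1)`" = `∃ δ₀ > 0`, hypothesis
  `‖L(1,ψ)‖ log D ≤ δ₀` (uniform reading, equivalent to the sequential one — see that file); one
  constant `K` per fixed `(ε, A)`; `L(1,ψ), L'(1,ψ), L''(1,ψ)` = `ψ.LFunction 1`, `deriv`, `iteratedDeriv 2`
  of Mathlib's `DirichletCharacter.LFunction` at `1`.
* "Provided that `q, X ≥ D⁸`" / "`X ≥ D^{24}` and `D⁸X⁶ ≪ q^{1−ε}`": hypotheses with real powers; the
  `≪` is taken with implied constant `1` (`D⁸X⁶ ≤ q^{1−ε}`), a sub-case of the printed family.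
* The factors `(1 + O(log log(1/L(1,ψ) log D)/log(1/L(1,ψ) log D)))` of the `Λ''` statements are
  rendered as `∃ κ : ℂ, ‖κ − 1‖ ≤ K · log log(1/x)/log(1/x)` (`x = ‖L(1,ψ)‖ log D`) multiplying the
  printed main term.
* (2.2) is printed with a citation ("[21]") rather than proved in the paper; it is vendored as a
  named fact with that locator. `ε_f = q^{1/2}λ_f(q)` of (2.1) is not used here.
* HOW THE CELL READS THESE FACTS (B-fam KILL-draft §1 (III), planner 2026-08-26T19:12Z/19:33Z; erratum
  note, no statement changed): Propositions 2.1–2.3 are moments of the DERIVATIVES `Λ'_{f,ψ}(½)`,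
  `Λ''_{f,ψ}(½)` of the PRODUCT `Λ(f,s)Λ(f⊗ψ,s)`; through Cauchy–Schwarz they give Theorem 1.2
  (`AnalyticRanksLandauSiegel`, `buiPrattZaharescu2024_theorem12_*`), whose compatible clause reads:
  at prime levels `q` with `ψ(q) = −1` (the cell's compatible class `χ(−q) = +1`, `ψ` odd) and
  `L(1,ψ) log D = o(1)`, «`r_f ≤ 2` for almost all `f ∈ S₂*(q)`» [p0003] — a statement about RANKS via
  the product, which does NOT split the compatible class into `r_f = 0 | r_f = 2`: no proportion of
  `L(½,f) ≠ 0` beyond one half is asserted by it (the `r_f ≤ 1` clause is the incompatible case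
  `ψ(q) = +1`). These facts are therefore consistency EXHIBITS of the (A)-world calculus, not inputs that
  move the ½-proportion; the order-0 (value) display of the same chain, which is pure in `L(1,ψ)`, is
  the derivation target `BPZ2024.OrderZeroProductMoment` (`BPZProductMomentOrderZero`).

## References

* [BuiPrattZaharescu2023] §2 (2.1)–(2.7), Props. 2.1–2.3 (pp. 3–6 of the held text).
* [KowalskiMichelVanderKam2000] (harmonic weights, `∑ʰ 1 = 1 + O(q^{−3/2})` = `kmv2000_eq4`;
  Lemma 3.2 of BPZ = `kmv2000_lemma32`).
-/

noncomputable section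

open scoped Real
open CongruenceSubgroup Complex Finset
open Literature.NumberTheory.EllipticCurves.ModularForms

namespace Literature.NumberTheory.LFunctions

namespace BPZ2024

variable (q : ℕ) [NeZero q] {D : ℕ}

/-- `α(n) = ∏_{p ∣ n} (1 + 1/p)^{−1}` (BPZ §2.1, p. 4) — the reciprocal of KMV's `ψ(n)`
(`KMV2000.psi`). [cite: BuiPrattZaharescu2023, §2.1 p. 4 (α)] -/
def alpha (n : ℕ) : ℝ := (KMV2000.psi n)⁻¹

/-- `h(n) = h_ψ(n) = ∏_{p ∣ n} (1 + α(p)² ψ(p)/p)^{−1}` (BPZ (2.3)). [cite: BuiPrattZaharescu2023, §2.1 (2.3) (h)] -/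
def hfun (ψ : DirichletCharacter ℂ D) (n : ℕ) : ℂ :=
  ∏ p ∈ n.primeFactors, (1 + ((alpha p ^ 2 / p : ℝ) : ℂ) * ψ p)⁻¹

/-- **`ρ₁(a) = ((αμ) ⋆ (αμψ))(a) · h(a)`** (BPZ (2.3)): the mollifier coefficients, a Dirichlet
convolution over `mn = a`. [cite: BuiPrattZaharescu2023, §2.1 (2.3) (ρ₁)] -/
def rho1 (ψ : DirichletCharacter ℂ D) (a : ℕ) : ℂ :=
  (∑ mn ∈ a.divisorsAntidiagonal,
      ((alpha mn.1 * ArithmeticFunction.moebius mn.1 * alpha mn.2 *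
          ArithmeticFunction.moebius mn.2 : ℝ) : ℂ) * ψ mn.2) * hfun ψ a

/-- **The BPZ mollifier (2.3)** `M_{f,ψ} = ∑_{a ≤ X} ρ₁(a) λ_f(a) a^{−1/2}`.
[cite: BuiPrattZaharescu2023, §2.1 (2.3)] -/
def mollifier (ψ : DirichletCharacter ℂ D) (X : ℝ) (f : CuspForm (Gamma0 q) 2) : ℂ :=
  ∑ a ∈ Icc 1 ⌊X⌋₊, rho1 ψ a * GL2Family.heckeLambda f a * ((a : ℝ) ^ (-(1 / 2 : ℝ)) : ℝ)

/-- `Λ(f, ½ + u) := (√q/2π)^u Γ(1+u) L(f, ½+u)` (BPZ (2.1)), with `L(f, ½+u) = E(1+u)` for the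
entire continuation of record `E` of `∑ a_n n^{−s}` (classical centre `1`), as a function of `u`.
[cite: BuiPrattZaharescu2023, §2 (2.1)] -/
def Lambda (f : CuspForm (Gamma0 q) 2) (u : ℂ) : ℂ :=
  ((KMV2000.qhat q : ℝ) : ℂ) ^ u * Complex.Gamma (1 + u) *
    IwaniecSarnak.entireLSeries (cuspCoeff f) 2 (1 + u)

/-- `Λ(f ⊗ ψ, ½ + u) := (√q D/2π)^u Γ(1+u) L(f⊗ψ, ½+u)` (BPZ p. 4), `L(f⊗ψ, s) = ∑ ψ(n)λ_f(n)n^{−s}`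
continued (`IwaniecSarnak.entireLSeries` of `n ↦ ψ(n) a_n(f)`). [cite: BuiPrattZaharescu2023, §2 p. 4 (Λ(f⊗ψ))] -/
def LambdaTw (ψ : DirichletCharacter ℂ D) (f : CuspForm (Gamma0 q) 2) (u : ℂ) : ℂ :=
  ((KMV2000.qhat q * D : ℝ) : ℂ) ^ u * Complex.Gamma (1 + u) *
    IwaniecSarnak.entireLSeries (fun n ↦ ψ n * cuspCoeff f n) 2 (1 + u)

/-- **`Λ_{f,ψ}(½ + u) := Λ(f, ½+u) Λ(f⊗ψ, ½+u)`** (BPZ (2.2)), as a function of `u`.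
[cite: BuiPrattZaharescu2023, §2 (2.2)] -/
def LambdaProd (ψ : DirichletCharacter ℂ D) (f : CuspForm (Gamma0 q) 2) (u : ℂ) : ℂ :=
  Lambda q f u * LambdaTw q ψ f u

/-- `Λ^{(k)}_{f,ψ}(½)`: the `k`-th derivative of the product at the centre (`u = 0`).
[cite: BuiPrattZaharescu2023, §2 p. 4 (Λ'_{f,ψ}(1/2), Λ''_{f,ψ}(1/2))] -/
def LambdaProdDeriv (ψ : DirichletCharacter ℂ D) (k : ℕ) (f : CuspForm (Gamma0 q) 2) : ℂ :=
  iteratedDeriv k (LambdaProd q ψ f) 0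

/-- **The singular series `S₁`** (BPZ (2.6)):
`S₁ = ∏_{p∣D}(1+1/p)^{−1} ∏_{p ≤ X, p ∤ D} ((1+1/p)² + ψ(p)/p)^{−1} (1 − ψ(p)/p)`.
[cite: BuiPrattZaharescu2023, Prop. 2.1 (2.6)] -/
def S1 (ψ : DirichletCharacter ℂ D) (X : ℝ) : ℂ :=
  (∏ p ∈ D.primeFactors, (((1 + (p : ℝ)⁻¹)⁻¹ : ℝ) : ℂ)) *
    ∏ p ∈ (range (⌊X⌋₊ + 1)).filter (fun p ↦ p.Prime ∧ ¬ p ∣ D),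
      ((((1 + (p : ℝ)⁻¹) ^ 2 : ℝ) : ℂ) + ψ p / p)⁻¹ * (1 - ψ p / p)

/-- **`S₂ = S₁²`** (BPZ (2.7)). [cite: BuiPrattZaharescu2023, Prop. 2.2 (2.7)] -/
def S2 (ψ : DirichletCharacter ℂ D) (X : ℝ) : ℂ := S1 ψ X ^ 2

/-- `Q = qD/4π²` (BPZ Lemma 3.4 / Prop. 2.1). [cite: BuiPrattZaharescu2023, Lemma 3.4 (Q)] -/
def Qbpz (q D : ℕ) : ℝ := q * D / (4 * π ^ 2)

end BPZ2024

/-! ### Named facts (Bui–Pratt–Zaharescu 2024, §2), as printed -/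

section Facts

open BPZ2024

/-- **BPZ 2024, (2.2): the functional equation of the product.** Printed (p. 4): for `f ∈ S₂*(q)`
(`q` prime), `ψ` primitive mod `D`, `(D, q) = 1`: `Λ(f⊗ψ, ½+s) = −ψ(q)ε_f Λ(f⊗ψ, ½−s)` "[21]", hence
"`Λ_{f,ψ}(½+s) := Λ(f,½+s)Λ(f⊗ψ,½+s) = −ψ(q) Λ_{f,ψ}(½−s)` (2.2)". Typed for the paper's standing
`ψ` (real, odd, primitive). Printed with a citation, not proved in the source.
[cite: BuiPrattZaharescu2023, §2 (2.2)] -/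
def buiPrattZaharescu2024_eq22 : Prop :=
  ∀ (q : ℕ) [NeZero q], q.Prime → ∀ (D : ℕ) [NeZero D] (ψ : DirichletCharacter ℂ D),
    ψ.IsPrimitive → ψ.IsQuadratic → ψ.Odd → q.Coprime D →
      ∀ f ∈ newforms0 q 2, ∀ u : ℂ, LambdaProd q ψ f u = -ψ (q : ZMod D) * LambdaProd q ψ f (-u)

/-- **BPZ 2024, Proposition 2.1, first display.** Printed: "Provided that `q, X ≥ D⁸` we have
`∑ʰ_{f ∈ S₂*(q)} Λ'_{f,ψ}(½) M_{f,ψ} = 2(1 + ψ(q)) S₁ L'(1,ψ) + O_ε(L(1,ψ)(log q)^{7+ε}) +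
O_A((log q)^{−A}) + O_ε(q^{−1/2+ε} D X)`" (standing: `q` prime, `ψ` real odd primitive mod `D`, `D`
large, `L(1,ψ) log D = o(1)`). [cite: BuiPrattZaharescu2023, Prop. 2.1 (first display)] -/
def buiPrattZaharescu2024_proposition21_first : Prop :=
  ∀ ε : ℝ, 0 < ε → ∀ A : ℝ, 0 < A →
    ∃ K : ℝ, 0 < K ∧ ∃ δ₀ : ℝ, 0 < δ₀ ∧ ∃ D₀ : ℕ, ∀ (D : ℕ) [NeZero D], D₀ ≤ D →
      ∀ ψ : DirichletCharacter ℂ D, ψ.IsPrimitive → ψ.IsQuadratic → ψ.Odd →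
        ‖ψ.LFunction 1‖ * Real.log D ≤ δ₀ →
        ∀ (q : ℕ) [NeZero q], q.Prime → (D : ℝ) ^ (8 : ℝ) ≤ (q : ℝ) → ∀ X : ℝ, (D : ℝ) ^ (8 : ℝ) ≤ X →
          ‖GL2Family.harmonicSum q 2 (fun f ↦ LambdaProdDeriv q ψ 1 f * mollifier q ψ X f) -
              2 * (1 + ψ (q : ZMod D)) * S1 ψ X * deriv ψ.LFunction 1‖ ≤
            K * (‖ψ.LFunction 1‖ * Real.log q ^ (7 + ε) + Real.log q ^ (-A) +
              (q : ℝ) ^ (-(1 / 2 : ℝ) + ε) * D * X)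

/-- **BPZ 2024, Proposition 2.1, second display.** Printed: "`∑ʰ_{f ∈ S₂*(q)} Λ''_{f,ψ}(½) M_{f,ψ} =
4(1 − ψ(q)) S₁ (1 + O(log log(1/L(1,ψ) log D)/log(1/L(1,ψ) log D))) (L''(1,ψ) + (log Q − 2γ)L'(1,ψ))
+ O_ε(L(1,ψ)(log q)^{8+ε}) + O_ε(q^{−1/2+ε} D X)`", `Q = qD/4π²`, same provisos (`q, X ≥ D⁸`). The
relative factor is an `∃ κ`, `‖κ − 1‖ ≤ K log log(1/x)/log(1/x)`, `x = ‖L(1,ψ)‖ log D`.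
[cite: BuiPrattZaharescu2023, Prop. 2.1 (second display)] -/
def buiPrattZaharescu2024_proposition21_second : Prop :=
  ∀ ε : ℝ, 0 < ε →
    ∃ K : ℝ, 0 < K ∧ ∃ δ₀ : ℝ, 0 < δ₀ ∧ ∃ D₀ : ℕ, ∀ (D : ℕ) [NeZero D], D₀ ≤ D →
      ∀ ψ : DirichletCharacter ℂ D, ψ.IsPrimitive → ψ.IsQuadratic → ψ.Odd →
        ‖ψ.LFunction 1‖ * Real.log D ≤ δ₀ →
        ∀ (q : ℕ) [NeZero q], q.Prime → (D : ℝ) ^ (8 : ℝ) ≤ (q : ℝ) → ∀ X : ℝ, (D : ℝ) ^ (8 : ℝ) ≤ X →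
          ∃ κ : ℂ, ‖κ - 1‖ ≤ K * (Real.log (Real.log (1 / (‖ψ.LFunction 1‖ * Real.log D))) /
                Real.log (1 / (‖ψ.LFunction 1‖ * Real.log D))) ∧
            ‖GL2Family.harmonicSum q 2 (fun f ↦ LambdaProdDeriv q ψ 2 f * mollifier q ψ X f) -
                4 * (1 - ψ (q : ZMod D)) * S1 ψ X * κ *
                  (iteratedDeriv 2 ψ.LFunction 1 +
                    ((Real.log (Qbpz q D) - 2 * Real.eulerMascheroniConstant : ℝ) : ℂ) *
                      deriv ψ.LFunction 1)‖ ≤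
              K * (‖ψ.LFunction 1‖ * Real.log q ^ (8 + ε) + (q : ℝ) ^ (-(1 / 2 : ℝ) + ε) * D * X)

/-- **BPZ 2024, Proposition 2.2.** Printed: "Provided that `X ≥ D^{24}` and `D⁸X⁶ ≪ q^{1−ε}` we have
`∑ʰ_{f ∈ S₂*(q)} Λ'_{f,ψ}(½)² M²_{f,ψ} = 4(1 + ψ(q))² S₂ L'(1,ψ)² + O_ε(L(1,ψ)(log q)^{37+ε}) +
O_A((log q)^{−A}) + O_ε(q^{−1/12+ε} D^{5/3} X^{5/2}) + O_ε(q^{−1/4+ε} D^{17/4} X^{19/4})`", `S₂ = S₁²`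
(standing provisos; `≪` with implied constant `1`). [cite: BuiPrattZaharescu2023, Prop. 2.2] -/
def buiPrattZaharescu2024_proposition22 : Prop :=
  ∀ ε : ℝ, 0 < ε → ∀ A : ℝ, 0 < A →
    ∃ K : ℝ, 0 < K ∧ ∃ δ₀ : ℝ, 0 < δ₀ ∧ ∃ D₀ : ℕ, ∀ (D : ℕ) [NeZero D], D₀ ≤ D →
      ∀ ψ : DirichletCharacter ℂ D, ψ.IsPrimitive → ψ.IsQuadratic → ψ.Odd →
        ‖ψ.LFunction 1‖ * Real.log D ≤ δ₀ →
        ∀ (q : ℕ) [NeZero q], q.Prime → ∀ X : ℝ, (D : ℝ) ^ (24 : ℝ) ≤ X →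
          (D : ℝ) ^ (8 : ℝ) * X ^ (6 : ℝ) ≤ (q : ℝ) ^ (1 - ε) →
          ‖GL2Family.harmonicSum q 2 (fun f ↦ LambdaProdDeriv q ψ 1 f ^ 2 * mollifier q ψ X f ^ 2) -
              4 * (1 + ψ (q : ZMod D)) ^ 2 * S2 ψ X * deriv ψ.LFunction 1 ^ 2‖ ≤
            K * (‖ψ.LFunction 1‖ * Real.log q ^ (37 + ε) + Real.log q ^ (-A) +
              (q : ℝ) ^ (-(1 / 12 : ℝ) + ε) * (D : ℝ) ^ (5 / 3 : ℝ) * X ^ (5 / 2 : ℝ) +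
              (q : ℝ) ^ (-(1 / 4 : ℝ) + ε) * (D : ℝ) ^ (17 / 4 : ℝ) * X ^ (19 / 4 : ℝ))

/-- **BPZ 2024, Proposition 2.3.** Printed: "Provided that `X ≥ D^{24}` and `D⁸X⁶ ≪ q^{1−ε}` we have
`∑ʰ_{f ∈ S₂*(q)} Λ''_{f,ψ}(½)² M²_{f,ψ} = 16(1 − ψ(q))² S₂ (1 + O(log log(1/L(1,ψ) log D)/log(1/L(1,ψ)
log D))) (L''(1,ψ) + (log Q − 2γ)L'(1,ψ))² + O_ε(L(1,ψ)(log q)^{39+ε}) + O_ε(q^{−1/12+ε} D^{5/3}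
X^{5/2}) + O_ε(q^{−1/4+ε} D^{17/4} X^{19/4})`" (standing provisos; `≪` with implied constant `1`; the
relative factor as `∃ κ`). [cite: BuiPrattZaharescu2023, Prop. 2.3] -/
def buiPrattZaharescu2024_proposition23 : Prop :=
  ∀ ε : ℝ, 0 < ε →
    ∃ K : ℝ, 0 < K ∧ ∃ δ₀ : ℝ, 0 < δ₀ ∧ ∃ D₀ : ℕ, ∀ (D : ℕ) [NeZero D], D₀ ≤ D →
      ∀ ψ : DirichletCharacter ℂ D, ψ.IsPrimitive → ψ.IsQuadratic → ψ.Odd →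
        ‖ψ.LFunction 1‖ * Real.log D ≤ δ₀ →
        ∀ (q : ℕ) [NeZero q], q.Prime → ∀ X : ℝ, (D : ℝ) ^ (24 : ℝ) ≤ X →
          (D : ℝ) ^ (8 : ℝ) * X ^ (6 : ℝ) ≤ (q : ℝ) ^ (1 - ε) →
          ∃ κ : ℂ, ‖κ - 1‖ ≤ K * (Real.log (Real.log (1 / (‖ψ.LFunction 1‖ * Real.log D))) /
                Real.log (1 / (‖ψ.LFunction 1‖ * Real.log D))) ∧
            ‖GL2Family.harmonicSum q 2
                  (fun f ↦ LambdaProdDeriv q ψ 2 f ^ 2 * mollifier q ψ X f ^ 2) -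
                16 * (1 - ψ (q : ZMod D)) ^ 2 * S2 ψ X * κ *
                  (iteratedDeriv 2 ψ.LFunction 1 +
                    ((Real.log (Qbpz q D) - 2 * Real.eulerMascheroniConstant : ℝ) : ℂ) *
                      deriv ψ.LFunction 1) ^ 2‖ ≤
              K * (‖ψ.LFunction 1‖ * Real.log q ^ (39 + ε) +
                (q : ℝ) ^ (-(1 / 12 : ℝ) + ε) * (D : ℝ) ^ (5 / 3 : ℝ) * X ^ (5 / 2 : ℝ) +
                (q : ℝ) ^ (-(1 / 4 : ℝ) + ε) * (D : ℝ) ^ (17 / 4 : ℝ) * X ^ (19 / 4 : ℝ))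

end Facts

end Literature.NumberTheory.LFunctions
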